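import Summits.AtomisticToContinuum.FouriersLaw.Theorems.EmbeddedDrudeMourreNessUniqueDuhamel

/-!
# Resolvent identification of weak flip steady states, part 5: Duhamel's formula with an arbitrary rate

Helper file for crux `NoisyFourier` (stmt-AtomisticToContinuum-11977, route `VanishingNoiseTransfer`), line
`sector-dirichlet-gluing`, registered stub `stub_flipSteadyState_eq_bind_resolventKernel`. The `ε = 0` file
`EmbeddedDrudeMourreNessUniqueDuhamel.lean` with the integrating factor `e^{2γs}` replaced by `e^{cs}` for an
arbitrary real constant `c` (for the flip steady state `c = 2γ - Nε`, of either sign), and the integrated bound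
stated for an arbitrary bounded continuous integrand:

* `revKernel_duhamel_const` — `e^{ct} P̂_t f(y) - f(y) = ∫₀ᵗ e^{cs} P̂_s (L̂ f + c f)(y) ds` for `f ∈ C²_c`;
* `lintegral_abs_timeIntegral_revKernel_le` — `∫ |∫₀ᵗ e^{cs} P̂_s E(y) ds| dy ≤ e^{|c|t} · t · ∫ |E| dx` for bounded
  continuous `E` (Lebesgue measure is `e^{-2γs}`-contracted by `P̂_s`).

No definitions.
-/

noncomputable section

open MeasureTheory ProbabilityTheory Filter Topology Set
open scoped NNReal ENNReal ContDiff

namespace Summit.AtomisticToContinuum.FouriersLaw.Theorems.NoisyFourier.FlipResolvent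

open Literature.MathematicalPhysics.KineticTheory.HeatConduction
open Literature.MathematicalPhysics.KineticTheory Literature.Probability.Process OscillatorChain
open Summit.AtomisticToContinuum.FouriersLaw.Theorems.SubdiffusiveBondHeat
open Summit.AtomisticToContinuum.FouriersLaw.Theorems.NessUnique

variable {N : ℕ} {P : OscillatorChain}

section Duhamel

variable (T_L T_R : ℝ)

/-- **Duhamel's formula for the reversed kernels with an arbitrary rate**: for `f ∈ C²_c`, a real constant `c`,
`t ≥ 0` and every `y`, `e^{ct} ∫ f dP̂_t(y,·) - f(y) = ∫₀ᵗ e^{cs} ∫ (L̂ f + c f) dP̂_s(y,·) ds` (Dynkin's identity for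
the reversed equation and the integrating factor `e^{cs}`). [folklore] -/
theorem revKernel_duhamel_const (hP : P.IsConfining) (c : ℝ) {f : PhaseSpace N → ℝ} (hf : ContDiff ℝ 2 f)
    (hfc : HasCompactSupport f) (t : ℝ≥0) (y : PhaseSpace N) :
    Real.exp (c * t) * ∫ x, f x ∂(P.langevinRevKernel N T_L T_R t y) - f y =
      ∫ s in (0 : ℝ)..(t : ℝ), Real.exp (c * s) *
        ∫ x, (sdeGenerator (fun z => -P.drift N z) (P.bathVecL N T_L) (P.bathVecR N T_R) f x + c * f x)
          ∂(P.langevinRevKernel N T_L T_R s.toNNReal y) := by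
  set D := hP.reversedDrift N with hD
  have hv₁ := hP.bathVecL_mem_reversedDrift_noise N T_L
  have hv₂ := hP.bathVecR_mem_reversedDrift_noise N T_R
  set κ : ℝ≥0 → Kernel (PhaseSpace N) (PhaseSpace N) := P.langevinRevKernel N T_L T_R with hκ
  have hκs : ∀ s, κ s = sdeKernel (fun z => -P.drift N z) (P.bathVecL N T_L) (P.bathVecR N T_R) s := fun s => rfl
  haveI hprob : ∀ s z, IsProbabilityMeasure (κ s z) := fun s z =>
    isProbabilityMeasure_langevinRevKernel hP N T_L T_R s z
  set Lf := sdeGenerator (fun z => -P.drift N z) (P.bathVecL N T_L) (P.bathVecR N T_R) f with hLf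
  have hYc : Continuous fun z => -P.drift N z := D.contDiff_drift.continuous
  have hfcont : Continuous f := hf.continuous
  have hLc : Continuous Lf := continuous_sdeGenerator _ _ hYc hf
  obtain ⟨Cf, hCf⟩ := hfcont.bounded_above_of_compact_support hfc
  obtain ⟨CL, hCL⟩ := exists_bound_sdeGenerator (P.bathVecL N T_L) (P.bathVecR N T_R) hYc hf hfc
  set E : PhaseSpace N → ℝ := fun x => Lf x + c * f x with hE
  have hEc : Continuous E := hLc.add (continuous_const.mul hfcont)
  have hEb : ∀ x, ‖E x‖ ≤ CL + |c| * Cf := fun x => by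
    calc ‖E x‖ ≤ ‖Lf x‖ + ‖c * f x‖ := norm_add_le _ _
      _ ≤ CL + |c| * Cf := by
          rw [norm_mul, Real.norm_eq_abs]
          exact add_le_add (hCL x) (mul_le_mul_of_nonneg_left (hCf x) (abs_nonneg c))
  -- the three time functions
  set Φ : ℝ → ℝ := fun s => ∫ x, f x ∂(κ s.toNNReal y) with hΦ
  set Ψ : ℝ → ℝ := fun s => ∫ x, Lf x ∂(κ s.toNNReal y) with hΨ
  set e : ℝ → ℝ := fun s => ∫ x, E x ∂(κ s.toNNReal y) with he
  have hΦc : Continuous Φ := continuous_integral_langevinRevKernel hP N T_L T_R y hfcont hCf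
  have hΨc : Continuous Ψ := continuous_integral_langevinRevKernel hP N T_L T_R y hLc hCL
  have hec : Continuous e := continuous_integral_langevinRevKernel hP N T_L T_R y hEc hEb
  have he_eq : ∀ s, e s = Ψ s + c * Φ s := by
    intro s
    have i1 : Integrable Lf (κ s.toNNReal y) :=
      (integrable_const CL).mono' hLc.aestronglyMeasurable (Eventually.of_forall hCL)
    have i2 : Integrable f (κ s.toNNReal y) :=
      (integrable_const Cf).mono' hfcont.aestronglyMeasurable (Eventually.of_forall hCf)
    simp only [he, hΨ, hΦ, hE]
    rw [integral_add i1 (i2.const_mul c), integral_const_mul]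
  -- Dynkin for the reversed equation
  have hdyn : ∀ u : ℝ, 0 ≤ u → Φ u - f y = ∫ s in (0:ℝ)..u, Ψ s := by
    intro u hu
    have h := D.sdeKernel_dynkin hv₁ hv₂ hf hfc u.toNNReal y
    rw [Real.coe_toNNReal _ hu, ← hκs] at h
    simp only [hΦ, hΨ]
    rw [h]
    refine intervalIntegral.integral_congr fun s _ => ?_
    rw [← hκs]
  have hΦ0 : Φ 0 = f y := sub_eq_zero.1 (by simpa using hdyn 0 le_rfl)
  -- the integrating factor
  set G : ℝ → ℝ := fun s => Real.exp (c * s) * Φ s with hG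
  have hGc : Continuous G := (Real.continuous_exp.comp (continuous_const.mul continuous_id)).mul hΦc
  have hGderiv : ∀ x : ℝ, 0 ≤ x → HasDerivWithinAt G (Real.exp (c * x) * e x) (Ici x) x := by
    intro x hx0
    have hΦd : HasDerivWithinAt Φ (Ψ x) (Ici x) x := by
      have hF : HasDerivAt (fun s => f y + ∫ r in (0:ℝ)..s, Ψ r) (Ψ x) x :=
        (hΨc.integral_hasStrictDerivAt 0 x).hasDerivAt.const_add (f y)
      refine hF.hasDerivWithinAt.congr (fun s hs => ?_) ?_
      · have := hdyn s (hx0.trans hs); linarith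
      · have := hdyn x hx0; linarith
    have hexp : HasDerivWithinAt (fun s => Real.exp (c * s)) (Real.exp (c * x) * c) (Ici x) x := by
      have h1 : HasDerivAt (fun s : ℝ => c * s) c x := by simpa using (hasDerivAt_id x).const_mul c
      exact h1.exp.hasDerivWithinAt
    have := hexp.mul hΦd
    refine this.congr_deriv ?_
    rw [he_eq x]; ring
  -- fundamental theorem of calculus on `[0, t]`
  have hftc : ∫ s in (0:ℝ)..(t:ℝ), Real.exp (c * s) * e s = G t - G 0 := by
    refine intervalIntegral.integral_eq_sub_of_hasDeriv_right_of_le t.coe_nonneg hGc.continuousOn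
      (fun x hx => (hGderiv x hx.1.le).mono Set.Ioi_subset_Ici_self) ?_
    exact ((Real.continuous_exp.comp (continuous_const.mul continuous_id)).mul hec).intervalIntegrable _ _
  have hGt : G t = Real.exp (c * t) * ∫ x, f x ∂(κ t y) := by
    simp only [hG, hΦ, Real.toNNReal_coe]
  have hG0 : G 0 = f y := by simp only [hG]; rw [mul_zero, Real.exp_zero, one_mul, hΦ0]
  rw [hGt, hG0] at hftc
  rw [← hftc]

/-- `s ↦ ∫ E dP̂_{s⁺}(y, ·)` is continuous for bounded continuous `E` (time-continuity of the reversed kernels),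
restated for use with the weight `e^{cs}`: `s ↦ e^{cs} ∫ E dP̂_{s⁺}(y,·)` is interval integrable. [folklore] -/
theorem intervalIntegrable_exp_mul_integral_revKernel (hP : P.IsConfining) (c : ℝ) {E : PhaseSpace N → ℝ}
    (hEc : Continuous E) {CE : ℝ} (hEb : ∀ x, ‖E x‖ ≤ CE) (y : PhaseSpace N) (a b : ℝ) :
    IntervalIntegrable (fun s : ℝ => Real.exp (c * s) *
      ∫ x, E x ∂(P.langevinRevKernel N T_L T_R s.toNNReal y)) volume a b :=
  ((Real.continuous_exp.comp (continuous_const.mul continuous_id)).mul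
    (continuous_integral_langevinRevKernel hP N T_L T_R y hEc hEb)).intervalIntegrable _ _

/-- **The integrated bound on a weighted time integral of the reversed kernels**: for bounded continuous `E`,
a real `c` and `t ≥ 0`, `∫ |∫₀ᵗ e^{cs} ∫ E dP̂_s(y,·) ds| dy ≤ e^{|c|t} · t · ∫ |E| dx` (as an inequality of
Lebesgue integrals; duality: `∫ dy ∫ |E| dP̂_s(y,·) ≤ ∫ |E| dx`). [folklore] -/
theorem lintegral_abs_timeIntegral_revKernel_le (hP : P.IsConfining) (hU : ContDiff ℝ ((⊤ : ℕ∞) : WithTop ℕ∞) P.U)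
    (hV : ContDiff ℝ ((⊤ : ℕ∞) : WithTop ℕ∞) P.V) (hN : 0 < N) (c : ℝ)
    {E : PhaseSpace N → ℝ} (hEc : Continuous E) {CE : ℝ} (hEb : ∀ x, ‖E x‖ ≤ CE) (t : ℝ≥0) :
    ∫⁻ y, ENNReal.ofReal |∫ s in (0 : ℝ)..(t : ℝ), Real.exp (c * s) *
        ∫ x, E x ∂(P.langevinRevKernel N T_L T_R s.toNNReal y)| ≤
      ENNReal.ofReal (Real.exp (|c| * t)) * t * ∫⁻ x, ENNReal.ofReal |E x| := by
  set κ : ℝ≥0 → Kernel (PhaseSpace N) (PhaseSpace N) := P.langevinRevKernel N T_L T_R with hκ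
  haveI hprob : ∀ s z, IsProbabilityMeasure (κ s z) := fun s z =>
    isProbabilityMeasure_langevinRevKernel hP N T_L T_R s z
  -- the absolute integrand transported by the reversed kernels
  set a : ℝ → PhaseSpace N → ℝ := fun s y => ∫ x, |E x| ∂(κ s.toNNReal y) with ha
  have ha0 : ∀ s y, 0 ≤ a s y := fun s y => integral_nonneg fun x => abs_nonneg _
  have hac : ∀ y, Continuous fun s => a s y := fun y =>
    continuous_integral_langevinRevKernel hP N T_L T_R y hEc.abs (C := CE) fun x => by
      rw [Real.norm_eq_abs, abs_abs, ← Real.norm_eq_abs]; exact hEb x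
  -- pointwise: `|∫₀ᵗ e^{cs} P̂_s E ds| ≤ e^{|c|t} ∫₀ᵗ a(s, y) ds`
  have hpt : ∀ y, |∫ s in (0:ℝ)..(t:ℝ), Real.exp (c * s) * ∫ x, E x ∂(κ s.toNNReal y)| ≤
      Real.exp (|c| * t) * ∫ s in (0:ℝ)..(t:ℝ), a s y := by
    intro y
    have hle : ∀ s ∈ Set.Icc (0:ℝ) t, ‖Real.exp (c * s) * ∫ x, E x ∂(κ s.toNNReal y)‖ ≤ Real.exp (|c| * t) * a s y := by
      intro s hs
      rw [norm_mul, Real.norm_eq_abs, abs_of_pos (Real.exp_pos _)]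
      refine mul_le_mul (Real.exp_le_exp.2 ?_) ?_ (norm_nonneg _) (Real.exp_pos _).le
      · calc c * s ≤ |c| * s := mul_le_mul_of_nonneg_right (le_abs_self c) hs.1
          _ ≤ |c| * t := mul_le_mul_of_nonneg_left hs.2 (abs_nonneg c)
      · rw [Real.norm_eq_abs]
        exact abs_integral_le_integral_abs
    calc |∫ s in (0:ℝ)..(t:ℝ), Real.exp (c * s) * ∫ x, E x ∂(κ s.toNNReal y)|
        ≤ ∫ s in (0:ℝ)..(t:ℝ), Real.exp (|c| * t) * a s y := by
          rw [← Real.norm_eq_abs]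
          refine intervalIntegral.norm_integral_le_of_norm_le t.coe_nonneg ?_ ?_
          · exact Eventually.of_forall fun s hs => hle s ⟨hs.1.le, hs.2⟩
          · exact (continuous_const.mul (hac y)).intervalIntegrable _ _
      _ = Real.exp (|c| * t) * ∫ s in (0:ℝ)..(t:ℝ), a s y := by
          rw [intervalIntegral.integral_const_mul]
  -- convert the inner time integral to a Lebesgue integral over `Ioc 0 t`
  have hconv : ∀ y, ENNReal.ofReal (Real.exp (|c| * t) * ∫ s in (0:ℝ)..(t:ℝ), a s y) =
      ENNReal.ofReal (Real.exp (|c| * t)) * ∫⁻ s in Set.Ioc (0:ℝ) t, ENNReal.ofReal (a s y) := by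
    intro y
    rw [ENNReal.ofReal_mul (Real.exp_pos _).le, intervalIntegral.integral_of_le t.coe_nonneg,
      ofReal_integral_eq_lintegral_ofReal]
    · exact ((hac y).integrableOn_Icc).mono_set Set.Ioc_subset_Icc_self
    · exact Eventually.of_forall fun s => ha0 s y
  -- `a(s, y)` as a Lebesgue integral, and its measurability in `(y, s)`
  have ha_eq : ∀ s y, ENNReal.ofReal (a s y) = ∫⁻ x, ENNReal.ofReal |E x| ∂(κ s.toNNReal y) := by
    intro s y
    rw [ha]
    exact ofReal_integral_eq_lintegral_ofReal
      ((integrable_const CE).mono' hEc.abs.aestronglyMeasurable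
        (Eventually.of_forall fun x => by rw [Real.norm_eq_abs, abs_abs, ← Real.norm_eq_abs]; exact hEb x))
      (Eventually.of_forall fun x => abs_nonneg _)
  have hmeasE : Measurable fun x => ENNReal.ofReal |E x| := hEc.abs.measurable.ennreal_ofReal
  have hmeas : Measurable fun p : PhaseSpace N × ℝ => ENNReal.ofReal (a p.2 p.1) := by
    have e : (fun p : PhaseSpace N × ℝ => ENNReal.ofReal (a p.2 p.1)) =
        fun p => ∫⁻ x, ENNReal.ofReal |E x| ∂(P.langevinRevKernel N T_L T_R p.2.toNNReal p.1) :=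
      funext fun p => ha_eq p.2 p.1
    rw [e]
    exact measurable_lintegral_revKernel T_L T_R hP hmeasE
  -- the `y`-integral of `a(s, ·)` is at most `‖E‖₁` for `s > 0`
  have hslice : ∀ s : ℝ, 0 < s → ∫⁻ y, ENNReal.ofReal (a s y) ≤ ∫⁻ x, ENNReal.ofReal |E x| := by
    intro s hs
    simp_rw [ha_eq]
    exact lintegral_revKernel_le T_L T_R hP hU hV hN (t := s.toNNReal) (Real.toNNReal_pos.2 hs) hmeasE
  -- assemble with Tonelli
  calc ∫⁻ y, ENNReal.ofReal |∫ s in (0:ℝ)..(t:ℝ), Real.exp (c * s) * ∫ x, E x ∂(κ s.toNNReal y)|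
      ≤ ∫⁻ y, ENNReal.ofReal (Real.exp (|c| * t)) * ∫⁻ s in Set.Ioc (0:ℝ) t, ENNReal.ofReal (a s y) := by
        refine lintegral_mono fun y => ?_
        rw [← hconv y]
        exact ENNReal.ofReal_le_ofReal (hpt y)
    _ = ENNReal.ofReal (Real.exp (|c| * t)) * ∫⁻ y, ∫⁻ s in Set.Ioc (0:ℝ) t, ENNReal.ofReal (a s y) :=
        lintegral_const_mul' _ _ ENNReal.ofReal_ne_top
    _ = ENNReal.ofReal (Real.exp (|c| * t)) * ∫⁻ s in Set.Ioc (0:ℝ) t, ∫⁻ y, ENNReal.ofReal (a s y) := by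
        rw [lintegral_lintegral_swap hmeas.aemeasurable]
    _ ≤ ENNReal.ofReal (Real.exp (|c| * t)) * ∫⁻ _ in Set.Ioc (0:ℝ) t, ∫⁻ x, ENNReal.ofReal |E x| :=
        mul_le_mul_right (setLIntegral_mono' measurableSet_Ioc fun s hs => hslice s hs.1) _
    _ = ENNReal.ofReal (Real.exp (|c| * t)) * t * ∫⁻ x, ENNReal.ofReal |E x| := by
        rw [setLIntegral_const, Real.volume_Ioc, sub_zero, ENNReal.ofReal_coe_nnreal]
        ring

end Duhamel

/-- Registered helper (notation-free restatement of `revKernel_duhamel_const`). -/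
theorem helper_flipRevKernelDuhamelConst : ∀ (N : ℕ) (P : Literature.MathematicalPhysics.KineticTheory.HeatConduction.OscillatorChain) (T_L T_R : ℝ), P.IsConfining → ∀ (c : ℝ) (f : Literature.MathematicalPhysics.KineticTheory.HeatConduction.PhaseSpace N → ℝ), ContDiff ℝ 2 f → HasCompactSupport f → ∀ (t : NNReal) (y : Literature.MathematicalPhysics.KineticTheory.HeatConduction.PhaseSpace N), Real.exp (c * (t : ℝ)) * MeasureTheory.integral (P.langevinRevKernel N T_L T_R t y) (fun x => f x) - f y = intervalIntegral (fun s : ℝ => Real.exp (c * s) * MeasureTheory.integral (P.langevinRevKernel N T_L T_R s.toNNReal y) (fun x => Literature.MathematicalPhysics.KineticTheory.sdeGenerator (fun z => -P.drift N z) (P.bathVecL N T_L) (P.bathVecR N T_R) f x + c * f x)) 0 (t : ℝ) MeasureTheory.volume :=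
  fun _ _ T_L T_R hP c _ hf hfc t y => revKernel_duhamel_const T_L T_R hP c hf hfc t y

end Summit.AtomisticToContinuum.FouriersLaw.Theorems.NoisyFourier.FlipResolvent

end
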